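import Summits.HodgeConjecture.CorCM.MumfordTateRankSeven
import Summits.HodgeConjecture.CorCM.MumfordTateRankFiveCenter
import Literature.AlgebraicGeometry.Motives.HodgeLieWeightOneGradingTwoCenter
import HarnessLib

/-!
# The rung `dim MT(H¹(X)) = 7` with `ℚ`-SIMPLE Hodge Lie algebra, I: the `ad(2P−1)`-grading dichotomy and, in the
# `Res_{K/ℚ} SL₂` position, the centre of `End⁰(X)` is a REAL QUADRATIC FIELD

COR-CM (cell `pub-hodgecm2`, seat `b27` gen 40, count-neutral lane MT-RANK-SEVEN-SIMPLE; theorems only, no definition, no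
named fact; UNCONDITIONAL — nothing here uses or asserts HC_CM).  Sequel of `CorCM/MumfordTateRankSevenSemisimple` (gen 39:
for `𝔷 = 0` and `dim MT(H¹X) = 7`, `Lie Hg(H¹X)` is `ℚ`-simple or `X ∼ B₁^{a+1} × B₂^{b+1}`), treating the `ℚ`-SIMPLE
branch with the abstract weight-one theory `Literature/…/Motives/HodgeLieWeightOneGrading*` (gen 40).

For a complex abelian variety `X` with `0 < dim X`, `𝔷 = Lie Hg(H¹X) ∩ End_Hdg(H¹X) = 0` and `dim MT(H¹X) = 7`:

* `finrank_grading_dichotomy_of_center_eq_bot_of_mtRank_eq_seven` — for every Hodge-graded basis of `H¹(X, ℂ)` the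
  `ad(2P−1)`-grading of `Lie Hg(H¹X) ⊗ ℂ` has `(dim 𝔤⁺, dim 𝔤⁻, dim 𝔤⁰) = (1, 1, 4)` (TYPE-III POSITION: `V_ℂ ≅ std ⊗ W`,
  `E F = αP`; classically powers of a simple abelian fourfold with definite quaternion multiplication, Moonen–Zarhin
  (2.3), Thm. (2)(c)) or `(2, 2, 2)` (the `Res_{K/ℚ} SL₂` position).
* **`center_endAlgebra_of_isSimple_of_finrank_gradingPlus_eq_two`** — if moreover `Lie Hg(H¹X)` is `ℚ`-SIMPLE and the
  position is `(2, 2, 2)`, then: `dim_ℚ End⁰(X) = k₁² + k₂²` with `kᵢ ≥ 1`, `k₁ + k₂ = dim X`; **the centre `Z(End⁰X)`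
  is a real quadratic field**: `dim_ℚ Z(End⁰X) = 2`, no zero-divisors, `Z(End⁰X) = ℚ ⊕ ℚφ` with `φ² = q`,
  `0 < q ∈ ℚ` not a square.  PROOF: the abstract `center_structure_of_finrank_gradingPlus_eq_two` on `H¹(X)`; its
  «ideal» alternative is excluded by simplicity (the kernel `{W ∈ 𝔥 : Wz = 0}` would be a non-zero proper Lie ideal);
  transport `End_Hdg(H¹X) ≅ End⁰(X)ᵒᵖ` by Riemann (`bettiRep`, `exists_unop_bettiRep_eq_of_mem_endAlg`).

The sequel `CorCM/MumfordTateRankSevenSimpleIsogeny` draws the isogeny classification (`X ∼ B^j`, `B` an abelian surface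
with real multiplication by `K = Z(End⁰X)` or a fourfold with quaternion multiplication over `K`).

## References

* [MoonenZarhin1999LowDim] B. Moonen, Yu. Zarhin, *Hodge classes on abelian varieties of low dimension*, Math. Ann.
  315 (1999), §2 («`End⁰(X) = End_{Hg} H¹`»), (2.3) and Thm. (2)(c) (types I(2), II(2), III(1)).
* [Deligne1982HodgeCycles] P. Deligne, *Hodge cycles on abelian varieties*, LNM 900 (1982), I §3 Prop. 3.4–3.6.
* [DeligneMilne1982Tannakian] P. Deligne, J. S. Milne, *Tannakian Categories*, LNM 900 (1982), II Thm. 6.20 (Riemann).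
* [Humphreys1972] J. E. Humphreys, *Introduction to Lie Algebras and Representation Theory*, GTM 9 (1972), §4.2, §6.1.
-/

noncomputable section

open scoped TensorProduct
open CategoryTheory CategoryTheory.Limits Module

namespace Summit.HodgeConjecture.CorCM

open Literature.AlgebraicGeometry.Motives
open Literature.AlgebraicGeometry.Motives.AbelianVariety
open Literature.AlgebraicGeometry.Motives.HodgeStructure
open Literature.AlgebraicGeometry.HodgeTheory
open Literature.AlgebraicGeometry.ComplexMultiplication (bettiRep bettiRep_injective)

variable [HodgeTensorFacts.{0, 0}] {X : AbelianVariety ℂ} {n : ℕ}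

/-- **The grading dichotomy at `dim MT(H¹X) = 7`, `𝔷 = 0`.**  For every Hodge-graded basis `e` of `H¹(X, ℂ)` (degrees
`deg`, `P = gradingEnd e deg` the projector onto `H^{1,0}`), the `ad(2P−1)`-grading of `Lie Hg(H¹X) ⊗ ℂ` has dimensions
`(dim 𝔤⁺, dim 𝔤⁻, dim 𝔤⁰) = (1, 1, 4)` (type-III position) or `(2, 2, 2)` (`Res_{K/ℚ} SL₂` position):
`dim Lie Hg = 6` (`finrank_hodgeLie_eq_six_of_center_eq_bot_of_mtRank_eq_seven`) and `Lie Hg ⊄ End_Hdg`.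
[cite: MoonenZarhin1999LowDim, §2 and (2.3)] [cite: Deligne1982HodgeCycles, I §3 (proof of Prop. 3.4)] -/
theorem finrank_grading_dichotomy_of_center_eq_bot_of_mtRank_eq_seven (hX : IsSmoothProjective n X.X) (h0 : 0 < X.dim)
    (hz : haveI := BettiUniverse.finite hX 1
      (BettiUniverse.hodge exists_isReal_hodgeModel_holds hX 1).hodgeLie ⊓
        Subalgebra.toSubmodule (BettiUniverse.hodge exists_isReal_hodgeModel_holds hX 1).endAlg = ⊥)
    (h7 : haveI := BettiUniverse.finite hX 1
      (BettiUniverse.hodge exists_isReal_hodgeModel_holds hX 1).mtRank = 7)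
    {S : Type} [Fintype S] [DecidableEq S] {deg : S → ℤ} (e : Module.Basis S ℂ (ℂ ⊗[ℚ] bettiCohomology X.X 1))
    (hF : ∀ a, (BettiUniverse.hodge exists_isReal_hodgeModel_holds hX 1).F a = Submodule.span ℂ (e '' {σ | a ≤ deg σ}))
    (hFc : ∀ a, complexConj ((BettiUniverse.hodge exists_isReal_hodgeModel_holds hX 1).F a) =
      Submodule.span ℂ (e '' {σ | deg σ ≤ ((1 : ℕ) : ℤ) - a})) :
    haveI := BettiUniverse.finite hX 1
    (Module.finrank ℂ ((BettiUniverse.hodge exists_isReal_hodgeModel_holds hX 1).hodgeLieC ⊓ Module.End.eigenspace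
          (LinearMap.mulLeft ℂ (gradingEnd e deg) - LinearMap.mulRight ℂ (gradingEnd e deg)) 1 : Submodule ℂ _) = 1 ∧
      Module.finrank ℂ ((BettiUniverse.hodge exists_isReal_hodgeModel_holds hX 1).hodgeLieC ⊓ Module.End.eigenspace
          (LinearMap.mulLeft ℂ (gradingEnd e deg) - LinearMap.mulRight ℂ (gradingEnd e deg)) (-1) : Submodule ℂ _) = 1 ∧
      Module.finrank ℂ ((BettiUniverse.hodge exists_isReal_hodgeModel_holds hX 1).hodgeLieC ⊓ Module.End.eigenspace
          (LinearMap.mulLeft ℂ (gradingEnd e deg) - LinearMap.mulRight ℂ (gradingEnd e deg)) 0 : Submodule ℂ _) = 4) ∨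
    (Module.finrank ℂ ((BettiUniverse.hodge exists_isReal_hodgeModel_holds hX 1).hodgeLieC ⊓ Module.End.eigenspace
          (LinearMap.mulLeft ℂ (gradingEnd e deg) - LinearMap.mulRight ℂ (gradingEnd e deg)) 1 : Submodule ℂ _) = 2 ∧
      Module.finrank ℂ ((BettiUniverse.hodge exists_isReal_hodgeModel_holds hX 1).hodgeLieC ⊓ Module.End.eigenspace
          (LinearMap.mulLeft ℂ (gradingEnd e deg) - LinearMap.mulRight ℂ (gradingEnd e deg)) (-1) : Submodule ℂ _) = 2 ∧
      Module.finrank ℂ ((BettiUniverse.hodge exists_isReal_hodgeModel_holds hX 1).hodgeLieC ⊓ Module.End.eigenspace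
          (LinearMap.mulLeft ℂ (gradingEnd e deg) - LinearMap.mulRight ℂ (gradingEnd e deg)) 0 : Submodule ℂ _) = 2) := by
  haveI := BettiUniverse.finite hX 1
  set H := BettiUniverse.hodge exists_isReal_hodgeModel_holds hX 1 with hH
  obtain ⟨-, h6⟩ := finrank_hodgeLie_eq_six_of_center_eq_bot_of_mtRank_eq_seven hX h0 hz h7
  have heff := BettiUniverse.hodge_isEffective exists_isReal_hodgeModel_holds hX 1
  have hdeg : ∀ σ, deg σ = 0 ∨ deg σ = 1 := fun σ => by
    have h := heff.deg_mem_Icc_of_graded e hF hFc σ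
    simp only [Nat.cast_one] at h
    omega
  have hne : ¬ H.hodgeLie ≤ Subalgebra.toSubmodule H.endAlg := by
    intro hle
    have h : H.hodgeLie = ⊥ := by rw [← inf_eq_left.2 hle]; exact hz
    rw [h, finrank_bot] at h6
    exact absurd h6 (by norm_num)
  exact finrank_grading_of_finrank_eq_six H (by simp) e hF hFc hdeg h6 hne

/-- **In the `Res_{K/ℚ} SL₂` position with `ℚ`-SIMPLE `Lie Hg(H¹X)`, the centre of `End⁰(X)` is a real quadratic
field.**  Hypotheses: `0 < dim X`, `𝔷 = 0`, `dim MT(H¹X) = 7`, every Lie subalgebra of `𝔤𝔩(H¹X)` with carrier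
`Lie Hg(H¹X)` is simple, and `dim 𝔤⁺ = 2` for some Hodge-graded basis.  Conclusions: `dim_ℚ End⁰(X) = k₁² + k₂²`,
`kᵢ ≥ 1`, `k₁ + k₂ = dim X`; `dim_ℚ Z(End⁰X) = 2`; `Z(End⁰X)` has no zero-divisors and equals `ℚ·1 ⊕ ℚ·φ` with
`φ² = q`, `0 < q ∈ ℚ` not a square.  PROOF: `center_structure_of_finrank_gradingPlus_eq_two` for `H¹(X)`; its ideal
alternative contradicts simplicity; Riemann's `End⁰(X)ᵒᵖ ≅ End_Hdg(H¹X)` (`bettiRep`) transports the centre.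
[cite: MoonenZarhin1999LowDim, §2 and (2.3)] [cite: DeligneMilne1982Tannakian, II §6 Thm. 6.20]
[cite: Humphreys1972, §6.1] -/
theorem center_endAlgebra_of_isSimple_of_finrank_gradingPlus_eq_two (hX : IsSmoothProjective n X.X) (h0 : 0 < X.dim)
    (hz : haveI := BettiUniverse.finite hX 1
      (BettiUniverse.hodge exists_isReal_hodgeModel_holds hX 1).hodgeLie ⊓
        Subalgebra.toSubmodule (BettiUniverse.hodge exists_isReal_hodgeModel_holds hX 1).endAlg = ⊥)
    (h7 : haveI := BettiUniverse.finite hX 1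
      (BettiUniverse.hodge exists_isReal_hodgeModel_holds hX 1).mtRank = 7)
    (hsimple : haveI := BettiUniverse.finite hX 1
      letI : LieRing (Module.End ℚ (bettiCohomology X.X 1)) := LieRing.ofAssociativeRing
      ∀ 𝔏 : LieSubalgebra ℚ (Module.End ℚ (bettiCohomology X.X 1)),
        𝔏.toSubmodule = (BettiUniverse.hodge exists_isReal_hodgeModel_holds hX 1).hodgeLie → LieAlgebra.IsSimple ℚ 𝔏)
    {S : Type} [Fintype S] [DecidableEq S] {deg : S → ℤ} (e : Module.Basis S ℂ (ℂ ⊗[ℚ] bettiCohomology X.X 1))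
    (hF : ∀ a, (BettiUniverse.hodge exists_isReal_hodgeModel_holds hX 1).F a = Submodule.span ℂ (e '' {σ | a ≤ deg σ}))
    (hFc : ∀ a, complexConj ((BettiUniverse.hodge exists_isReal_hodgeModel_holds hX 1).F a) =
      Submodule.span ℂ (e '' {σ | deg σ ≤ ((1 : ℕ) : ℤ) - a}))
    (hp2 : haveI := BettiUniverse.finite hX 1
      Module.finrank ℂ ((BettiUniverse.hodge exists_isReal_hodgeModel_holds hX 1).hodgeLieC ⊓ Module.End.eigenspace
        (LinearMap.mulLeft ℂ (gradingEnd e deg) - LinearMap.mulRight ℂ (gradingEnd e deg)) 1 : Submodule ℂ _) = 2) :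
    ∃ (k₁ k₂ : ℕ) (φ : X.endAlgebra) (q : ℚ), 0 < k₁ ∧ 0 < k₂ ∧ X.dim = k₁ + k₂ ∧
      Module.finrank ℚ X.endAlgebra = k₁ ^ 2 + k₂ ^ 2 ∧
      Module.finrank ℚ (Subalgebra.center ℚ X.endAlgebra) = 2 ∧
      φ ∈ Subalgebra.center ℚ X.endAlgebra ∧ 0 < q ∧ ¬ IsSquare q ∧ φ * φ = algebraMap ℚ X.endAlgebra q ∧
      (∀ z ∈ Subalgebra.center ℚ X.endAlgebra, ∃ a b : ℚ, z = algebraMap ℚ X.endAlgebra a + b • φ) ∧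
      (∀ z ∈ Subalgebra.center ℚ X.endAlgebra, ∀ w ∈ Subalgebra.center ℚ X.endAlgebra, z * w = 0 → z = 0 ∨ w = 0) := by
  classical
  have hn : X.dim = n := schemeDim_eq_holds hX
  subst hn
  haveI := BettiUniverse.finite hX 1
  letI : LieRing (Module.End ℚ (bettiCohomology X.X 1)) := LieRing.ofAssociativeRing
  set H := BettiUniverse.hodge exists_isReal_hodgeModel_holds hX 1 with hH
  obtain ⟨hder, h6⟩ := finrank_hodgeLie_eq_six_of_center_eq_bot_of_mtRank_eq_seven hX h0 hz h7
  have heff := BettiUniverse.hodge_isEffective exists_isReal_hodgeModel_holds hX 1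
  have hdeg : ∀ σ, deg σ = 0 ∨ deg σ = 1 := fun σ => by
    have h := heff.deg_mem_Icc_of_graded e hF hFc σ
    simp only [Nat.cast_one] at h
    omega
  obtain ⟨ψ⟩ := BettiUniverse.hodge_isPolarizable exists_isReal_hodgeModel_holds hX 1
  -- `dim 𝔤⁰ = 2`
  have h02 : Module.finrank ℂ (H.hodgeLieC ⊓ Module.End.eigenspace
      (LinearMap.mulLeft ℂ (gradingEnd e deg) - LinearMap.mulRight ℂ (gradingEnd e deg)) 0 : Submodule ℂ _) = 2 := by
    rcases finrank_grading_dichotomy_of_center_eq_bot_of_mtRank_eq_seven hX h0 hz h7 e hF hFc with ⟨h1, -, -⟩ | ⟨-, -, h⟩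
    · rw [hp2] at h1; exact absurd h1 (by norm_num)
    · exact h
  obtain ⟨k₁, k₂, hk₁, hk₂, hdimV, hdimE, hZ2, halt⟩ :=
    center_structure_of_finrank_gradingPlus_eq_two H ψ (by simp) e hF hFc hdeg hz h6 hp2 h02
  -- the ideal alternative contradicts simplicity
  have hfield : ∃ (φ : Module.End ℚ (bettiCohomology X.X 1)) (q : ℚ),
      φ ∈ Subalgebra.toSubmodule (H.endAlg ⊓ Subalgebra.centralizer ℚ (H.endAlg : Set _)) ∧ 0 < q ∧ ¬ IsSquare q ∧
      φ * φ = q • (1 : Module.End ℚ (bettiCohomology X.X 1)) ∧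
      (∀ z ∈ Subalgebra.toSubmodule (H.endAlg ⊓ Subalgebra.centralizer ℚ (H.endAlg : Set _)),
        ∃ a b : ℚ, z = a • (1 : Module.End ℚ _) + b • φ) ∧
      (∀ z ∈ Subalgebra.toSubmodule (H.endAlg ⊓ Subalgebra.centralizer ℚ (H.endAlg : Set _)),
        ∀ w ∈ Subalgebra.toSubmodule (H.endAlg ⊓ Subalgebra.centralizer ℚ (H.endAlg : Set _)),
        z * w = 0 → z = 0 ∨ w = 0) := by
    rcases halt with ⟨K, hKle, hKbot, hKtop, hKideal⟩ | h
    · exfalso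
      obtain ⟨𝔏, h𝔏⟩ := exists_lieSubalgebra_eq_hodgeLie_derived H
      rw [hder] at h𝔏
      have hmem : ∀ {x : Module.End ℚ (bettiCohomology X.X 1)}, x ∈ 𝔏 ↔ x ∈ H.hodgeLie := by
        intro x; rw [← LieSubalgebra.mem_toSubmodule, h𝔏]
      haveI := hsimple 𝔏 h𝔏
      let I : LieIdeal ℚ 𝔏 :=
        { carrier := {x | (x : Module.End ℚ (bettiCohomology X.X 1)) ∈ K}
          add_mem' := fun {a b} ha hb => by
            simp only [Set.mem_setOf_eq] at ha hb ⊢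
            exact K.add_mem ha hb
          zero_mem' := by simp only [Set.mem_setOf_eq, ZeroMemClass.coe_zero]; exact K.zero_mem
          smul_mem' := fun c {x} hx => by
            simp only [Set.mem_setOf_eq] at hx ⊢
            exact K.smul_mem c hx
          lie_mem := fun {w x} hx => by
            simp only [Set.mem_setOf_eq] at hx ⊢
            rw [LieSubalgebra.coe_bracket, LieRing.of_associative_ring_bracket]
            have h := hKideal _ hx _ (hmem.1 w.2)
            rw [← neg_sub]
            exact K.neg_mem h }
      have hI : ∀ x : 𝔏, x ∈ I ↔ (x : Module.End ℚ (bettiCohomology X.X 1)) ∈ K := fun x => Iff.rfl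
      rcases LieAlgebra.IsSimple.eq_bot_or_eq_top I with hbot | htop
      · apply hKbot
        rw [eq_bot_iff]
        intro x hx
        have hx' : (⟨x, hmem.2 (hKle hx)⟩ : 𝔏) ∈ I := (hI _).2 hx
        rw [hbot] at hx'
        rw [Submodule.mem_bot]
        exact congrArg Subtype.val ((LieSubmodule.mem_bot _).1 hx')
      · apply hKtop
        apply le_antisymm hKle
        intro x hx
        have hx' : (⟨x, hmem.2 hx⟩ : 𝔏) ∈ I := by rw [htop]; exact LieSubmodule.mem_top _
        exact (hI _).1 hx'
    · exact h
  obtain ⟨φ', q, hφ'Z, hq, hnsq, hφ'sq, hspanZ, hnzd⟩ := hfield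
  -- Riemann: `End⁰(X)ᵒᵖ ≅ End_Hdg(H¹X)` via `bettiRep`
  have hρmul : ∀ w w' : X.endAlgebra,
      MulOpposite.unop (bettiRep X (w * w')) = MulOpposite.unop (bettiRep X w') * MulOpposite.unop (bettiRep X w) :=
    fun w w' => by rw [map_mul, MulOpposite.unop_mul]
  have hρinj : ∀ w w' : X.endAlgebra, MulOpposite.unop (bettiRep X w) = MulOpposite.unop (bettiRep X w') → w = w' :=
    fun w w' h => bettiRep_injective (MulOpposite.unop_injective h)
  have hρA : ∀ w : X.endAlgebra, MulOpposite.unop (bettiRep X w) ∈ H.endAlg := fun w =>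
    Literature.AlgebraicGeometry.ComplexMultiplication.unop_bettiRep_mem_endAlg exists_isReal_hodgeModel_holds
      hodgePQ_independent_of_hodgeModel_holds w
  have hρalg : ∀ r : ℚ, MulOpposite.unop (bettiRep X (algebraMap ℚ X.endAlgebra r)) =
      r • (1 : Module.End ℚ (bettiCohomology X.X 1)) := fun r => by
    rw [AlgHom.commutes, MulOpposite.algebraMap_apply, MulOpposite.unop_op, Algebra.algebraMap_eq_smul_one]
  -- membership in the centre transports
  have memZ : ∀ {a : Module.End ℚ (bettiCohomology X.X 1)},
      a ∈ Subalgebra.toSubmodule (H.endAlg ⊓ Subalgebra.centralizer ℚ (H.endAlg : Set _)) ↔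
        a ∈ H.endAlg ∧ ∀ b ∈ H.endAlg, b * a = a * b := fun {a} => by
    rw [Subalgebra.mem_toSubmodule, Algebra.mem_inf, Subalgebra.mem_centralizer_iff]; rfl
  have hcen_iff : ∀ w : X.endAlgebra, w ∈ Subalgebra.center ℚ X.endAlgebra ↔
      MulOpposite.unop (bettiRep X w) ∈ Subalgebra.toSubmodule (H.endAlg ⊓ Subalgebra.centralizer ℚ (H.endAlg : Set _)) := by
    intro w
    rw [Subalgebra.mem_center_iff, memZ]
    constructor
    · intro hw
      refine ⟨hρA w, fun b hb => ?_⟩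
      obtain ⟨w', rfl⟩ := exists_unop_bettiRep_eq_of_mem_endAlg hX hb
      rw [← hρmul, ← hρmul, hw w']
    · rintro ⟨-, hw⟩ w'
      apply hρinj
      rw [hρmul, hρmul]
      exact (hw _ (hρA w')).symm
  -- the rational representation as a linear map, injective with centre ↦ centre
  obtain ⟨ρ, hρdef⟩ : ∃ ρ : X.endAlgebra →ₗ[ℚ] Module.End ℚ (bettiCohomology X.X 1),
      ρ = (MulOpposite.opLinearEquiv ℚ (M := Module.End ℚ (bettiCohomology X.X 1))).symm.toLinearMap ∘ₗ
        (bettiRep X).toLinearMap := ⟨_, rfl⟩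
  have hρ : ∀ w, ρ w = MulOpposite.unop (bettiRep X w) := fun w => by rw [hρdef]; rfl
  have hρinj' : Function.Injective ρ := fun w w' h => hρinj w w' (by rw [← hρ, ← hρ, h])
  have hmap : Submodule.map ρ (Subalgebra.toSubmodule (Subalgebra.center ℚ X.endAlgebra)) =
      Subalgebra.toSubmodule (H.endAlg ⊓ Subalgebra.centralizer ℚ (H.endAlg : Set _)) := by
    apply le_antisymm
    · rintro _ ⟨w, hw, rfl⟩
      rw [hρ]
      exact (hcen_iff w).1 hw
    · intro a ha
      obtain ⟨w, hw⟩ := exists_unop_bettiRep_eq_of_mem_endAlg hX (memZ.1 ha).1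
      refine ⟨w, ?_, by rw [hρ, hw]⟩
      rw [Subalgebra.coe_toSubmodule, SetLike.mem_coe, hcen_iff, hw]
      exact ha
  have hZ2' : Module.finrank ℚ (Subalgebra.center ℚ X.endAlgebra) = 2 := by
    rw [← Subalgebra.finrank_toSubmodule,
      (Submodule.equivMapOfInjective ρ hρinj' (Subalgebra.toSubmodule (Subalgebra.center ℚ X.endAlgebra))).finrank_eq,
      hmap]
    exact hZ2
  -- transport `φ'`
  obtain ⟨φ, hφ⟩ := exists_unop_bettiRep_eq_of_mem_endAlg hX (memZ.1 hφ'Z).1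
  have hφcen : φ ∈ Subalgebra.center ℚ X.endAlgebra := (hcen_iff φ).2 (by rw [hφ]; exact hφ'Z)
  have hφsq : φ * φ = algebraMap ℚ X.endAlgebra q := by
    apply hρinj
    rw [hρmul, hφ, hφ'sq, hρalg]
  have hdimX : X.dim = k₁ + k₂ := by
    have h := finrank_bettiCohomology_one_eq_two_mul_dim X
    omega
  have hdimE' : Module.finrank ℚ X.endAlgebra = k₁ ^ 2 + k₂ ^ 2 := by
    rw [finrank_endAlgebra_eq_finrank_endAlg hX]; exact hdimE
  refine ⟨k₁, k₂, φ, q, hk₁, hk₂, hdimX, hdimE', hZ2', hφcen, hq, hnsq, hφsq, fun z hz => ?_, fun z hz w hw hzw => ?_⟩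
  · obtain ⟨a, b, hab⟩ := hspanZ _ ((hcen_iff z).1 hz)
    refine ⟨a, b, hρinj _ _ ?_⟩
    rw [hab, map_add, MulOpposite.unop_add, hρalg, map_smul, MulOpposite.unop_smul, hφ]
  · have h := hnzd _ ((hcen_iff w).1 hw) _ ((hcen_iff z).1 hz) (by rw [← hρmul, hzw, map_zero, MulOpposite.unop_zero])
    rcases h with h | h
    · right; exact hρinj _ _ (by rw [h, map_zero, MulOpposite.unop_zero])
    · left; exact hρinj _ _ (by rw [h, map_zero, MulOpposite.unop_zero])

end Summit.HodgeConjecture.CorCM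

end
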